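import Literature.Algebra.Module.DVRModuleType
import Mathlib.RingTheory.DiscreteValuationRing.Basic
import HarnessLib

/-!
# Howard 2004, Thm. 1.4.2 ⇒ the two displayed sentences of its proof (Prop. 1.4.1's skew pairings `( , )_{s,1}`):
# the SYMPLECTIC MODEL PAIRING on `(R/ϖ^e)^ε × (M × M)` — proofs file (generic module algebra over a DVR)

Topic `NumberTheory/GaloisCohomology/Howard2004`; namespace `Literature.NumberTheory.GaloisCohomology.Howard2004.DecompositionModel`.
THEOREMS ONLY: no definition, no named fact, no instance, no notation, no `sorry`. Cell `pub/bsd-print-x9` (seat x10b-p1-w7 g11,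
brick «C451-CONVERSE», `--supports stmt-BirchSwinnertonDyer-22642`); consumer = the sequel
`CasselsTateSkewPairingOfLevelDecompositionsProofs` (`DVRSetting.skewPairings_display_of_hasLevelDecompositionsAt`,
`prop141_casselsTate_skewPairing_atLevel_iff_forall_hasLevelDecompositionsAt`).

SOURCE. B. Howard, *The Heegner point Kolyvagin system*, Compositio Math. **140** (2004) = arXiv:1202.6340, proof of Thm. 1.4.2
(p0008 L108–L142): from Prop. 1.4.1 (Flach 1990) Howard reads, on `ℋ = H¹_𝓕(K,T)`, (i) a nondegenerate pairing
`( , )_{s,1} : V_s × W_s = ℋ[𝔪^s]/𝔪ℋ[𝔪^{s+1}] × ℋ[𝔪]/𝔪^sℋ[𝔪^{s+1}] → R[𝔪]` and (ii) `(a, π^{s-1}b)_{s,1} = -(b, π^{s-1}a)_{s,1}`, and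
DEDUCES `ℋ ≅ R^ε ⊕ M ⊕ M`.  This file is the CONVERSE, pure algebra: on the model `X = (R/ϖ^e)^ε × (M × M)`,
`M = Π_j R/(ϖ^{n_j})`, `1 ≤ n_j ≤ e`, for every `s = t + 1 < e` there IS a bi-additive `R`-equivariant pairing
`P : X[ϖ^s] × X[ϖ] → R/𝔪` with LEFT kernel exactly `ϖ·X[ϖ^{s+1}]`, RIGHT kernel exactly `ϖ^s·X[ϖ^{s+1}]` and the skew identity —
the symplectic model `P(x, w) = Σ_{j : n_j ≤ s} (red(x_j⁽¹⁾)·top(w_j⁽²⁾) − red(x_j⁽²⁾)·top(w_j⁽¹⁾))` (`red : R/ϖ^{n_j} → R/𝔪` the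
reduction, `top [ϖ^{n_j-1} r] = [r]` the top coefficient on the `ϖ`-torsion): `dim V_s = dim W_s = 2·#{j : n_j ≤ s}`, the cross
terms with `n_j < s` die under `ϖ^{s-1}`, and the length-`s` block is alternating.

WHAT IS PROVED.
* §0 (private) arithmetic in `R/(ϖ^c)`: divisibility of `ϖ^a`-torsion elements, the top coefficient and its well-definedness;
* §1 **`exists_skewPairing_model`** — the five clauses on the model, domains any additive subgroups `A = X[ϖ^{t+1}]`, `B = X[ϖ]`
  given by membership;
* §2 **`exists_skewPairing_of_linearEquiv`** — transport to any submodule `L ≤ V` with `L ≃ₗ[R] X` (domains `A`, `B ≤ V` cut out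
  by `x ∈ L ∧ ϖ^{t+1} • x = 0`, `w ∈ L ∧ ϖ • w = 0`; kernels `∃ z ∈ L, …`).

HONEST FRAMING: this is the EASY direction (structure ⇒ pairings); it does not construct Flach's pairing and proves neither
Prop. 1.4.1 nor Thm. 1.4.2; `thm161_dvrKolyvaginBound` is not proved; no summit statement is proved; BSD is not proved by this.
-/

set_option autoImplicit false

open Module Submodule

namespace Literature.NumberTheory.GaloisCohomology.Howard2004

namespace DecompositionModel

/-! ## §0 Arithmetic in the cyclic layers `R/(ϖ^c)` (private) -/

section CommRing

variable {R : Type*} [CommRing R] {ϖ : R}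

/-- `r • [x] = [r x]` in a quotient ring `R/I` (as an `R`-module). [folklore] -/
private theorem smul_mk_eq (I : Ideal R) (r x : R) :
    r • Ideal.Quotient.mk I x = Ideal.Quotient.mk I (r * x) := by
  rw [Algebra.smul_def, Ideal.Quotient.algebraMap_eq, map_mul]

/-- `ϖ^a • [ϖ^{c-a} y] = 0` in `R/(ϖ^c)` for `a ≤ c`. [folklore] -/
private theorem pow_smul_mk_pow_sub_mul_eq_zero {I : Ideal R} {c : ℕ} (hI : I = Ideal.span {ϖ ^ c})
    {a : ℕ} (hac : a ≤ c) (y : R) :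
    ϖ ^ a • Ideal.Quotient.mk I (ϖ ^ (c - a) * y) = 0 := by
  rw [smul_mk_eq, Ideal.Quotient.eq_zero_iff_mem, hI, Ideal.mem_span_singleton, ← mul_assoc, ← pow_add,
    Nat.add_sub_cancel' hac]
  exact dvd_mul_right _ _

/-- `ϖ^a • [ϖ^b y] = 0` in `R/(ϖ^c)` whenever `c ≤ a + b`. [folklore] -/
private theorem pow_smul_mk_pow_mul_eq_zero_of_le {I : Ideal R} {c : ℕ} (hI : I = Ideal.span {ϖ ^ c})
    {a b : ℕ} (h : c ≤ a + b) (y : R) :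
    ϖ ^ a • Ideal.Quotient.mk I (ϖ ^ b * y) = 0 := by
  rw [smul_mk_eq, Ideal.Quotient.eq_zero_iff_mem, hI, Ideal.mem_span_singleton, ← mul_assoc, ← pow_add]
  exact (pow_dvd_pow ϖ h).mul_right y

/-- `ϖ^a • [y] = 0` in `R/(ϖ^c)` whenever `c ≤ a`. [folklore] -/
private theorem pow_smul_mk_eq_zero_of_le {I : Ideal R} {c : ℕ} (hI : I = Ideal.span {ϖ ^ c})
    {a : ℕ} (h : c ≤ a) (y : R) : ϖ ^ a • Ideal.Quotient.mk I y = 0 := by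
  simpa only [pow_zero, one_mul] using pow_smul_mk_pow_mul_eq_zero_of_le hI (a := a) (b := 0) (by omega) y

end CommRing

section Domain

variable {R : Type*} [CommRing R] [IsDomain R] {ϖ : R}

/-- **Divisibility in `R/(ϖ^c)`**: if `ϖ^a` kills `[x]` then `x = ϖ^{c-a} y` (truncated exponent; for `a > c`
take `y = x`). [folklore] -/
private theorem exists_eq_pow_mul_of_pow_smul_mk_eq_zero (hϖ : Irreducible ϖ) {I : Ideal R} {c : ℕ}
    (hI : I = Ideal.span {ϖ ^ c}) (a : ℕ) (x : R)
    (hx : ϖ ^ a • Ideal.Quotient.mk I x = 0) : ∃ y : R, x = ϖ ^ (c - a) * y := by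
  by_cases hac : a ≤ c
  · rw [smul_mk_eq, Ideal.Quotient.eq_zero_iff_mem, hI, Ideal.mem_span_singleton] at hx
    obtain ⟨y, hy⟩ := hx
    refine ⟨y, mul_left_cancel₀ (pow_ne_zero a hϖ.ne_zero) ?_⟩
    rw [hy, ← mul_assoc, ← pow_add, Nat.add_sub_cancel' hac]
  · exact ⟨x, by rw [Nat.sub_eq_zero_of_le (by omega), pow_zero, one_mul]⟩

/-- `[ϖ^{c-1} r] = 0` in `R/(ϖ^c)` (`1 ≤ c`) iff `ϖ ∣ r`. [folklore] -/
private theorem mk_pow_pred_mul_eq_zero_iff (hϖ : Irreducible ϖ) {c : ℕ} (hc : 1 ≤ c) (r : R) :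
    Ideal.Quotient.mk (Ideal.span {ϖ ^ c}) (ϖ ^ (c - 1) * r) = 0 ↔ ϖ ∣ r := by
  rw [Ideal.Quotient.eq_zero_iff_mem, Ideal.mem_span_singleton]
  constructor
  · rintro ⟨y, hy⟩
    refine ⟨y, mul_left_cancel₀ (pow_ne_zero (c - 1) hϖ.ne_zero) ?_⟩
    rw [hy, ← mul_assoc, ← pow_succ, Nat.sub_add_cancel hc]
  · rintro ⟨y, rfl⟩
    rw [← mul_assoc, ← pow_succ, Nat.sub_add_cancel hc]
    exact dvd_mul_right _ _

/-- **Divisibility in `R/(ϖ^c)`, element form**: `ϖ^a • u = 0 ⇒ u = [ϖ^{c-a} y]`. [folklore] -/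
private theorem exists_eq_mk_pow_sub_mul (hϖ : Irreducible ϖ) {I : Ideal R} {c : ℕ} (hI : I = Ideal.span {ϖ ^ c})
    (a : ℕ) (u : R ⧸ I) (hu : ϖ ^ a • u = 0) :
    ∃ y : R, u = Ideal.Quotient.mk I (ϖ ^ (c - a) * y) := by
  obtain ⟨x, rfl⟩ := Ideal.Quotient.mk_surjective u
  obtain ⟨y, rfl⟩ := exists_eq_pow_mul_of_pow_smul_mk_eq_zero hϖ hI a x hu
  exact ⟨y, rfl⟩

end Domain

section Helpers

variable {R : Type*} [CommRing R] [IsDomain R] [IsDiscreteValuationRing R] {ϖ : R}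

/-- `𝔪 = (ϖ)`: membership in the maximal ideal is divisibility by the uniformizer. [folklore] -/
private theorem mem_maximalIdeal_iff_dvd (hϖ : Irreducible ϖ) (r : R) :
    r ∈ IsLocalRing.maximalIdeal R ↔ ϖ ∣ r := by
  rw [(IsDiscreteValuationRing.irreducible_iff_uniformizer ϖ).mp hϖ, Ideal.mem_span_singleton]

/-- `(ϖ^c) ≤ 𝔪` for `1 ≤ c`. [folklore] -/
private theorem span_pow_le_maximalIdeal (hϖ : Irreducible ϖ) {c : ℕ} (hc : 1 ≤ c) :
    Ideal.span {ϖ ^ c} ≤ IsLocalRing.maximalIdeal R := by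
  rw [(IsDiscreteValuationRing.irreducible_iff_uniformizer ϖ).mp hϖ]
  exact Ideal.span_singleton_le_span_singleton.2 (dvd_pow_self ϖ (by omega))

/-- **Well-definedness of the «top coefficient»**: `[ϖ^{c-1} r] = [ϖ^{c-1} r']` in `R/(ϖ^c)` (`1 ≤ c`) forces
`r ≡ r' (mod 𝔪)`. [folklore] -/
private theorem mk_eq_mk_of_mk_pow_pred_mul_eq (hϖ : Irreducible ϖ) {c : ℕ} (hc : 1 ≤ c) {r r' : R}
    (h : Ideal.Quotient.mk (Ideal.span {ϖ ^ c}) (ϖ ^ (c - 1) * r) =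
      Ideal.Quotient.mk (Ideal.span {ϖ ^ c}) (ϖ ^ (c - 1) * r')) :
    Ideal.Quotient.mk (IsLocalRing.maximalIdeal R) r = Ideal.Quotient.mk (IsLocalRing.maximalIdeal R) r' := by
  rw [Ideal.Quotient.eq, Ideal.mem_span_singleton] at h
  obtain ⟨y, hy⟩ := h
  rw [Ideal.Quotient.eq, mem_maximalIdeal_iff_dvd hϖ]
  refine ⟨y, mul_left_cancel₀ (pow_ne_zero (c - 1) hϖ.ne_zero) ?_⟩
  rw [mul_sub, hy, ← mul_assoc, ← pow_succ, Nat.sub_add_cancel hc]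

/-- **The «top coefficient» functions** `top_j : R/(ϖ^{n_j}) → R/𝔪` with `top_j [ϖ^{n_j-1} r] = [r]`
(on the `ϖ`-torsion `ϖ^{n_j-1}R/ϖ^{n_j}R ≅ R/𝔪`; arbitrary off it). [folklore] -/
private theorem exists_top (hϖ : Irreducible ϖ) {m : ℕ} (n : Fin m → ℕ) (hn : ∀ j, 1 ≤ n j) :
    ∃ top : ∀ j : Fin m, R ⧸ Ideal.span {ϖ ^ n j} → R ⧸ IsLocalRing.maximalIdeal R,
      ∀ (j : Fin m) (r : R),
        top j (Ideal.Quotient.mk (Ideal.span {ϖ ^ n j}) (ϖ ^ (n j - 1) * r)) =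
          Ideal.Quotient.mk (IsLocalRing.maximalIdeal R) r := by
  classical
  refine ⟨fun j u ↦ if h : ∃ r : R, u = Ideal.Quotient.mk (Ideal.span {ϖ ^ n j}) (ϖ ^ (n j - 1) * r)
    then Ideal.Quotient.mk (IsLocalRing.maximalIdeal R) h.choose else 0, fun j r ↦ ?_⟩
  have h : ∃ r' : R, Ideal.Quotient.mk (Ideal.span {ϖ ^ n j}) (ϖ ^ (n j - 1) * r) =
      Ideal.Quotient.mk (Ideal.span {ϖ ^ n j}) (ϖ ^ (n j - 1) * r') := ⟨r, rfl⟩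
  show (if h : _ then _ else _) = _
  rw [dif_pos h]
  exact mk_eq_mk_of_mk_pow_pred_mul_eq hϖ (hn j) h.choose_spec.symm

end Helpers

/-! ## §1 The symplectic model pairing -/

section Model

variable {R : Type*} [CommRing R] [IsDomain R] [IsDiscreteValuationRing R] {ϖ : R}

/-- **THE SYMPLECTIC MODEL PAIRING (Howard Thm. 1.4.2 ⇒ the displays (i)(ii) of its proof, converse direction).**
On `X = (R/ϖ^e)^ε × (M × M)`, `M = Π_j R/(ϖ^{n_j})`, `1 ≤ n_j ≤ e`, and `s = t + 1 < e`: there is a bi-additive pairing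
`P : X[ϖ^{s}] × X[ϖ] → R/𝔪`, `R`-equivariant in both slots, with LEFT kernel exactly `ϖ·X[ϖ^{s+1}]`, RIGHT kernel
exactly `ϖ^s·X[ϖ^{s+1}]`, and skew: `P(a, ϖ^t b) = -P(b, ϖ^t a)` — namely
`P(x, w) = Σ_{j : n_j ≤ s} (red(x_j⁽¹⁾)·top(w_j⁽²⁾) − red(x_j⁽²⁾)·top(w_j⁽¹⁾))` (`red : R/ϖ^{n_j} → R/𝔪`,
`top [ϖ^{n_j-1} r] = [r]`): `dim V_s = dim W_s = 2·#{j : n_j ≤ s}` and the length-`s` block is alternating.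
[cite: Howard2004HeegnerKolyvagin, Thm. 1.4.2 (proof, displays (i)(ii)) (arXiv:1202.6340 p0008 L108–L142)] -/
theorem exists_skewPairing_model (hϖ : Irreducible ϖ) (ε m e : ℕ) (n : Fin m → ℕ)
    (hn : ∀ j, 1 ≤ n j ∧ n j ≤ e) (t : ℕ) (ht : t + 1 < e)
    (A B : AddSubgroup ((Fin ε → R ⧸ Ideal.span {ϖ ^ e}) ×
      ((Π j, R ⧸ Ideal.span {ϖ ^ n j}) × (Π j, R ⧸ Ideal.span {ϖ ^ n j}))))
    (hA : ∀ x, x ∈ A ↔ ϖ ^ (t + 1) • x = 0) (hB : ∀ w, w ∈ B ↔ ϖ • w = 0) :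
    ∃ P : ↥A →+ ↥B →+ R ⧸ IsLocalRing.maximalIdeal R,
      (∀ (r : R) (x x' : ↥A) (w : ↥B),
        (x' : (Fin ε → R ⧸ Ideal.span {ϖ ^ e}) ×
          ((Π j, R ⧸ Ideal.span {ϖ ^ n j}) × (Π j, R ⧸ Ideal.span {ϖ ^ n j}))) = r • (x : _) →
        P x' w = r • P x w) ∧
      (∀ (r : R) (x : ↥A) (w w' : ↥B),
        (w' : (Fin ε → R ⧸ Ideal.span {ϖ ^ e}) ×
          ((Π j, R ⧸ Ideal.span {ϖ ^ n j}) × (Π j, R ⧸ Ideal.span {ϖ ^ n j}))) = r • (w : _) →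
        P x w' = r • P x w) ∧
      (∀ x : ↥A, (∀ w, P x w = 0) ↔
        ∃ z : (Fin ε → R ⧸ Ideal.span {ϖ ^ e}) ×
          ((Π j, R ⧸ Ideal.span {ϖ ^ n j}) × (Π j, R ⧸ Ideal.span {ϖ ^ n j})),
          ϖ ^ (t + 2) • z = 0 ∧ (x : (Fin ε → R ⧸ Ideal.span {ϖ ^ e}) ×
          ((Π j, R ⧸ Ideal.span {ϖ ^ n j}) × (Π j, R ⧸ Ideal.span {ϖ ^ n j}))) = ϖ • z) ∧
      (∀ w : ↥B, (∀ x, P x w = 0) ↔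
        ∃ z : (Fin ε → R ⧸ Ideal.span {ϖ ^ e}) ×
          ((Π j, R ⧸ Ideal.span {ϖ ^ n j}) × (Π j, R ⧸ Ideal.span {ϖ ^ n j})),
          ϖ ^ (t + 2) • z = 0 ∧ (w : (Fin ε → R ⧸ Ideal.span {ϖ ^ e}) ×
          ((Π j, R ⧸ Ideal.span {ϖ ^ n j}) × (Π j, R ⧸ Ideal.span {ϖ ^ n j}))) = ϖ ^ (t + 1) • z) ∧
      (∀ (a b : ↥A) (a' b' : ↥B),
        (a' : (Fin ε → R ⧸ Ideal.span {ϖ ^ e}) ×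
          ((Π j, R ⧸ Ideal.span {ϖ ^ n j}) × (Π j, R ⧸ Ideal.span {ϖ ^ n j}))) = ϖ ^ t • (a : _) →
        (b' : (Fin ε → R ⧸ Ideal.span {ϖ ^ e}) ×
          ((Π j, R ⧸ Ideal.span {ϖ ^ n j}) × (Π j, R ⧸ Ideal.span {ϖ ^ n j}))) = ϖ ^ t • (b : _) →
        P a b' = - P b a') := by
  classical
  -- notation-free abbreviations
  set 𝔪 := IsLocalRing.maximalIdeal R with h𝔪def
  have hIe : (Ideal.span {ϖ ^ e} : Ideal R) = Ideal.span {ϖ ^ e} := rfl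
  have hIn : ∀ j, (Ideal.span {ϖ ^ n j} : Ideal R) = Ideal.span {ϖ ^ n j} := fun _ ↦ rfl
  have hmk𝔪ϖ : ∀ y : R, Ideal.Quotient.mk 𝔪 (ϖ * y) = 0 := fun y ↦ by
    rw [Ideal.Quotient.eq_zero_iff_mem, mem_maximalIdeal_iff_dvd hϖ]
    exact dvd_mul_right ϖ y
  -- the reductions `red_j : R/ϖ^{n_j} → R/𝔪`
  have hle : ∀ j, Ideal.span {ϖ ^ n j} ≤ 𝔪 := fun j ↦ span_pow_le_maximalIdeal hϖ (hn j).1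
  let red : ∀ j, R ⧸ Ideal.span {ϖ ^ n j} →+* R ⧸ 𝔪 := fun j ↦ Ideal.Quotient.factor (hle j)
  have hred : ∀ j (r : R), red j (Ideal.Quotient.mk _ r) = Ideal.Quotient.mk 𝔪 r := fun _ _ ↦ rfl
  have hred_smul : ∀ j (r : R) (u : R ⧸ Ideal.span {ϖ ^ n j}), red j (r • u) = r • red j u := by
    intro j r u
    obtain ⟨x, rfl⟩ := Ideal.Quotient.mk_surjective u
    rw [smul_mk_eq, hred, hred, smul_mk_eq]
  have hred_ϖ : ∀ j (u : R ⧸ Ideal.span {ϖ ^ n j}), red j (ϖ • u) = 0 := by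
    intro j u
    obtain ⟨x, rfl⟩ := Ideal.Quotient.mk_surjective u
    rw [smul_mk_eq, hred, hmk𝔪ϖ]
  -- the top coefficients `top_j`
  obtain ⟨top, htop⟩ := exists_top hϖ n (fun j ↦ (hn j).1)
  have htop0 : ∀ j, top j 0 = 0 := fun j ↦ by
    have h := htop j 0
    rwa [mul_zero, map_zero, map_zero] at h
  -- index set `J = {j : n_j ≤ s}`
  let J : Finset (Fin m) := Finset.univ.filter (fun j ↦ n j ≤ t + 1)
  have hJ : ∀ j, j ∈ J ↔ n j ≤ t + 1 := fun j ↦ by simp [J]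
  -- `top_j (ϖ^t • [β]) = [ϖ^{t+1-n_j} β]` for `j ∈ J`
  have htopA : ∀ j, n j ≤ t + 1 → ∀ β : R,
      top j (ϖ ^ t • Ideal.Quotient.mk _ β) = Ideal.Quotient.mk 𝔪 (ϖ ^ (t + 1 - n j) * β) := by
    intro j hj β
    have h1 := (hn j).1
    rw [smul_mk_eq, show ϖ ^ t * β = ϖ ^ (n j - 1) * (ϖ ^ (t + 1 - n j) * β) by
      rw [← mul_assoc, ← pow_add]; congr 2; omega, htop]
  -- representability of the coordinates of `w ∈ B` (all `ϖ`-torsion)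
  have hBtor : ∀ w : ↥B, ∀ j,
      ϖ ^ 1 • (w : (Fin ε → R ⧸ Ideal.span {ϖ ^ e}) × ((Π j, R ⧸ Ideal.span {ϖ ^ n j}) ×
        (Π j, R ⧸ Ideal.span {ϖ ^ n j}))).2.1 j = 0 ∧
      ϖ ^ 1 • (w : (Fin ε → R ⧸ Ideal.span {ϖ ^ e}) × ((Π j, R ⧸ Ideal.span {ϖ ^ n j}) ×
        (Π j, R ⧸ Ideal.span {ϖ ^ n j}))).2.2 j = 0 := by
    intro w j
    have h := (hB w).1 w.2
    refine ⟨?_, ?_⟩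
    · have h1 := congr_arg (fun y ↦ y.2.1 j) h
      simpa only [Prod.smul_snd, Prod.smul_fst, Pi.smul_apply, Prod.snd_zero, Prod.fst_zero,
        Pi.zero_apply, pow_one] using h1
    · have h1 := congr_arg (fun y ↦ y.2.2 j) h
      simpa only [Prod.smul_snd, Pi.smul_apply, Prod.snd_zero, Pi.zero_apply, pow_one] using h1
  choose ρ₁ hρ₁ using fun (w : ↥B) (j : Fin m) ↦ exists_eq_mk_pow_sub_mul hϖ (hIn j) 1 _ (hBtor w j).1
  choose ρ₂ hρ₂ using fun (w : ↥B) (j : Fin m) ↦ exists_eq_mk_pow_sub_mul hϖ (hIn j) 1 _ (hBtor w j).2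
  have htop₁ : ∀ (w : ↥B) j, top j ((w : (Fin ε → R ⧸ Ideal.span {ϖ ^ e}) ×
      ((Π j, R ⧸ Ideal.span {ϖ ^ n j}) × (Π j, R ⧸ Ideal.span {ϖ ^ n j}))).2.1 j) =
      Ideal.Quotient.mk 𝔪 (ρ₁ w j) := fun w j ↦ by rw [hρ₁ w j, htop]
  have htop₂ : ∀ (w : ↥B) j, top j ((w : (Fin ε → R ⧸ Ideal.span {ϖ ^ e}) ×
      ((Π j, R ⧸ Ideal.span {ϖ ^ n j}) × (Π j, R ⧸ Ideal.span {ϖ ^ n j}))).2.2 j) =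
      Ideal.Quotient.mk 𝔪 (ρ₂ w j) := fun w j ↦ by rw [hρ₂ w j, htop]
  -- additivity / equivariance of `top` along `B`
  have htop_add₁ : ∀ (w w' : ↥B) j, top j (((w + w' : ↥B) : (Fin ε → R ⧸ Ideal.span {ϖ ^ e}) ×
      ((Π j, R ⧸ Ideal.span {ϖ ^ n j}) × (Π j, R ⧸ Ideal.span {ϖ ^ n j}))).2.1 j) =
      top j (w.1.2.1 j) + top j (w'.1.2.1 j) := by
    intro w w' j
    have h : ((w + w' : ↥B) : (Fin ε → R ⧸ Ideal.span {ϖ ^ e}) ×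
        ((Π j, R ⧸ Ideal.span {ϖ ^ n j}) × (Π j, R ⧸ Ideal.span {ϖ ^ n j}))).2.1 j =
        Ideal.Quotient.mk _ (ϖ ^ (n j - 1) * (ρ₁ w j + ρ₁ w' j)) := by
      rw [AddSubgroup.coe_add, Prod.snd_add, Prod.fst_add, Pi.add_apply, hρ₁ w j, hρ₁ w' j, ← map_add,
        mul_add]
    rw [h, htop, htop₁, htop₁, map_add]
  have htop_add₂ : ∀ (w w' : ↥B) j, top j (((w + w' : ↥B) : (Fin ε → R ⧸ Ideal.span {ϖ ^ e}) ×
      ((Π j, R ⧸ Ideal.span {ϖ ^ n j}) × (Π j, R ⧸ Ideal.span {ϖ ^ n j}))).2.2 j) =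
      top j (w.1.2.2 j) + top j (w'.1.2.2 j) := by
    intro w w' j
    have h : ((w + w' : ↥B) : (Fin ε → R ⧸ Ideal.span {ϖ ^ e}) ×
        ((Π j, R ⧸ Ideal.span {ϖ ^ n j}) × (Π j, R ⧸ Ideal.span {ϖ ^ n j}))).2.2 j =
        Ideal.Quotient.mk _ (ϖ ^ (n j - 1) * (ρ₂ w j + ρ₂ w' j)) := by
      rw [AddSubgroup.coe_add, Prod.snd_add, Prod.snd_add, Pi.add_apply, hρ₂ w j, hρ₂ w' j, ← map_add,
        mul_add]
    rw [h, htop, htop₂, htop₂, map_add]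
  have htop_smul₁ : ∀ (r : R) (w w' : ↥B) j, (w' : (Fin ε → R ⧸ Ideal.span {ϖ ^ e}) ×
      ((Π j, R ⧸ Ideal.span {ϖ ^ n j}) × (Π j, R ⧸ Ideal.span {ϖ ^ n j}))) = r • (w : _) →
      top j (w'.1.2.1 j) = r • top j (w.1.2.1 j) := by
    intro r w w' j hw'
    have h : (w' : (Fin ε → R ⧸ Ideal.span {ϖ ^ e}) ×
        ((Π j, R ⧸ Ideal.span {ϖ ^ n j}) × (Π j, R ⧸ Ideal.span {ϖ ^ n j}))).2.1 j =
        Ideal.Quotient.mk _ (ϖ ^ (n j - 1) * (r * ρ₁ w j)) := by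
      rw [hw', Prod.smul_snd, Prod.smul_fst, Pi.smul_apply, hρ₁ w j, smul_mk_eq, mul_left_comm]
    rw [h, htop, htop₁, smul_mk_eq]
  have htop_smul₂ : ∀ (r : R) (w w' : ↥B) j, (w' : (Fin ε → R ⧸ Ideal.span {ϖ ^ e}) ×
      ((Π j, R ⧸ Ideal.span {ϖ ^ n j}) × (Π j, R ⧸ Ideal.span {ϖ ^ n j}))) = r • (w : _) →
      top j (w'.1.2.2 j) = r • top j (w.1.2.2 j) := by
    intro r w w' j hw'
    have h : (w' : (Fin ε → R ⧸ Ideal.span {ϖ ^ e}) ×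
        ((Π j, R ⧸ Ideal.span {ϖ ^ n j}) × (Π j, R ⧸ Ideal.span {ϖ ^ n j}))).2.2 j =
        Ideal.Quotient.mk _ (ϖ ^ (n j - 1) * (r * ρ₂ w j)) := by
      rw [hw', Prod.smul_snd, Prod.smul_snd, Pi.smul_apply, hρ₂ w j, smul_mk_eq, mul_left_comm]
    rw [h, htop, htop₂, smul_mk_eq]
  -- the raw pairing and its bundling
  let Praw : ↥A → ↥B → R ⧸ 𝔪 := fun x w ↦
    ∑ j ∈ J, (red j (x.1.2.1 j) * top j (w.1.2.2 j) - red j (x.1.2.2 j) * top j (w.1.2.1 j))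
  have hPraw : ∀ x w, Praw x w = ∑ j ∈ J,
      (red j (x.1.2.1 j) * top j (w.1.2.2 j) - red j (x.1.2.2 j) * top j (w.1.2.1 j)) :=
    fun _ _ ↦ rfl
  have hadd₂ : ∀ (x : ↥A) (w w' : ↥B), Praw x (w + w') = Praw x w + Praw x w' := by
    intro x w w'
    rw [hPraw, hPraw, hPraw, ← Finset.sum_add_distrib]
    refine Finset.sum_congr rfl fun j _ ↦ ?_
    rw [htop_add₁, htop_add₂]
    ring
  let Pin : ↥A → (↥B →+ R ⧸ 𝔪) := fun x ↦ AddMonoidHom.mk' (fun w ↦ Praw x w) (hadd₂ x)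
  have hPin : ∀ x w, Pin x w = Praw x w := fun _ _ ↦ rfl
  have hadd₁ : ∀ x x' : ↥A, Pin (x + x') = Pin x + Pin x' := by
    intro x x'
    refine AddMonoidHom.ext fun w ↦ ?_
    show Praw (x + x') w = Praw x w + Praw x' w
    rw [hPraw, hPraw, hPraw, ← Finset.sum_add_distrib]
    refine Finset.sum_congr rfl fun j _ ↦ ?_
    rw [AddSubgroup.coe_add, Prod.snd_add, Prod.fst_add, Prod.snd_add, Pi.add_apply, Pi.add_apply, map_add,
      map_add]
    ring
  let P : ↥A →+ ↥B →+ R ⧸ 𝔪 := AddMonoidHom.mk' Pin hadd₁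
  have hP : ∀ x w, P x w = ∑ j ∈ J,
      (red j (x.1.2.1 j) * top j (w.1.2.2 j) - red j (x.1.2.2 j) * top j (w.1.2.1 j)) :=
    fun _ _ ↦ rfl
  refine ⟨P, ?_, ?_, ?_, ?_, ?_⟩
  · -- `R`-equivariance in the first slot
    intro r x x' w hx'
    rw [hP, hP, Finset.smul_sum]
    refine Finset.sum_congr rfl fun j _ ↦ ?_
    rw [hx', Prod.smul_snd, Prod.smul_fst, Prod.smul_snd, Pi.smul_apply, Pi.smul_apply, hred_smul, hred_smul,
      smul_sub, smul_mul_assoc, smul_mul_assoc]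
  · -- `R`-equivariance in the second slot
    intro r x w w' hw'
    rw [hP, hP, Finset.smul_sum]
    refine Finset.sum_congr rfl fun j _ ↦ ?_
    rw [htop_smul₁ r w w' j hw', htop_smul₂ r w w' j hw', smul_sub, mul_smul_comm, mul_smul_comm]
  · -- LEFT kernel `= ϖ·X[ϖ^{s+1}]`
    intro x
    constructor
    · intro h
      -- Step 1: the `J`-coordinates of `x` reduce to `0` in `R/𝔪`
      let u : ∀ j, R ⧸ Ideal.span {ϖ ^ n j} := fun j ↦ Ideal.Quotient.mk _ (ϖ ^ (n j - 1) * 1)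
      have hu_top : ∀ j, top j (u j) = 1 := fun j ↦ by
        show top j (Ideal.Quotient.mk _ (ϖ ^ (n j - 1) * 1)) = 1
        rw [htop, map_one]
      have hu_tor : ∀ j, ϖ • u j = 0 := fun j ↦ by
        have h1 := pow_smul_mk_pow_sub_mul_eq_zero (hIn j) (a := 1) (hn j).1 (1 : R)
        rwa [pow_one] at h1
      have hw₂mem : ∀ j₀, ((0 : Fin ε → R ⧸ Ideal.span {ϖ ^ e}),
          ((0 : Π j, R ⧸ Ideal.span {ϖ ^ n j}), Pi.single j₀ (u j₀))) ∈ B := fun j₀ ↦ (hB _).2 (by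
        rw [Prod.smul_mk, Prod.smul_mk, smul_zero, smul_zero, ← Pi.single_smul, hu_tor, Pi.single_zero,
          Prod.mk_zero_zero, Prod.mk_zero_zero])
      have hw₁mem : ∀ j₀, ((0 : Fin ε → R ⧸ Ideal.span {ϖ ^ e}),
          (Pi.single j₀ (u j₀), (0 : Π j, R ⧸ Ideal.span {ϖ ^ n j}))) ∈ B := fun j₀ ↦ (hB _).2 (by
        rw [Prod.smul_mk, Prod.smul_mk, smul_zero, smul_zero, ← Pi.single_smul, hu_tor, Pi.single_zero,
          Prod.mk_zero_zero, Prod.mk_zero_zero])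
      have hred₁0 : ∀ j, n j ≤ t + 1 → red j (x.1.2.1 j) = 0 := by
        intro j₀ hj₀
        have h0 := h ⟨_, hw₂mem j₀⟩
        rw [hP, Finset.sum_eq_single_of_mem j₀ ((hJ j₀).2 hj₀)] at h0
        · dsimp only at h0
          rwa [Pi.single_eq_same, Pi.zero_apply, htop0, mul_zero, sub_zero, hu_top, mul_one] at h0
        · intro b _ hb
          dsimp only
          rw [Pi.single_eq_of_ne hb, Pi.zero_apply, htop0, mul_zero, mul_zero, sub_zero]
      have hred₂0 : ∀ j, n j ≤ t + 1 → red j (x.1.2.2 j) = 0 := by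
        intro j₀ hj₀
        have h0 := h ⟨_, hw₁mem j₀⟩
        rw [hP, Finset.sum_eq_single_of_mem j₀ ((hJ j₀).2 hj₀)] at h0
        · dsimp only at h0
          rwa [Pi.single_eq_same, Pi.zero_apply, htop0, mul_zero, zero_sub, hu_top, mul_one, neg_eq_zero] at h0
        · intro b _ hb
          dsimp only
          rw [Pi.single_eq_of_ne hb, Pi.zero_apply, htop0, mul_zero, mul_zero, sub_zero]
      -- Step 2: divide every coordinate of `x` by `ϖ`
      have hAx : ϖ ^ (t + 1) • x.1 = 0 := (hA _).1 x.2
      have hx0 : ∀ i, ϖ ^ (t + 1) • x.1.1 i = 0 := fun i ↦ by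
        have h1 := congr_arg (fun y ↦ y.1 i) hAx
        simpa only [Prod.smul_fst, Pi.smul_apply, Prod.fst_zero, Pi.zero_apply] using h1
      have hx1 : ∀ j, ϖ ^ (t + 1) • x.1.2.1 j = 0 := fun j ↦ by
        have h1 := congr_arg (fun y ↦ y.2.1 j) hAx
        simpa only [Prod.smul_snd, Prod.smul_fst, Pi.smul_apply, Prod.snd_zero, Prod.fst_zero,
          Pi.zero_apply] using h1
      have hx2 : ∀ j, ϖ ^ (t + 1) • x.1.2.2 j = 0 := fun j ↦ by
        have h1 := congr_arg (fun y ↦ y.2.2 j) hAx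
        simpa only [Prod.smul_snd, Pi.smul_apply, Prod.snd_zero, Pi.zero_apply] using h1
      have hfree : ∀ i, ∃ ζ : R, x.1.1 i = Ideal.Quotient.mk _ (ϖ * ζ) ∧
          ϖ ^ (t + 2) • Ideal.Quotient.mk (Ideal.span {ϖ ^ e}) ζ = 0 := by
        intro i
        obtain ⟨y, hy⟩ := exists_eq_mk_pow_sub_mul hϖ hIe (t + 1) _ (hx0 i)
        refine ⟨ϖ ^ (e - t - 2) * y, ?_, pow_smul_mk_pow_mul_eq_zero_of_le hIe (by omega) y⟩
        rw [hy, ← mul_assoc, ← pow_succ']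
        congr 3
        omega
      have hcoordA : ∀ j (v : R ⧸ Ideal.span {ϖ ^ n j}), ϖ ^ (t + 1) • v = 0 →
          (n j ≤ t + 1 → red j v = 0) →
          ∃ ζ : R, v = Ideal.Quotient.mk _ (ϖ * ζ) ∧
            ϖ ^ (t + 2) • Ideal.Quotient.mk (Ideal.span {ϖ ^ n j}) ζ = 0 := by
        intro j v hv hredv
        by_cases hj : n j ≤ t + 1
        · obtain ⟨ξ, rfl⟩ := Ideal.Quotient.mk_surjective v
          have h1 := hredv hj
          rw [hred, Ideal.Quotient.eq_zero_iff_mem, mem_maximalIdeal_iff_dvd hϖ] at h1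
          obtain ⟨ζ, rfl⟩ := h1
          exact ⟨ζ, rfl, pow_smul_mk_eq_zero_of_le (hIn j) (by omega) ζ⟩
        · obtain ⟨y, hy⟩ := exists_eq_mk_pow_sub_mul hϖ (hIn j) (t + 1) _ hv
          refine ⟨ϖ ^ (n j - t - 2) * y, ?_, pow_smul_mk_pow_mul_eq_zero_of_le (hIn j) (by omega) y⟩
          rw [hy, ← mul_assoc, ← pow_succ']
          congr 3
          omega
      choose ζ₀ hζ₀ hζ₀' using hfree
      choose ζ₁ hζ₁ hζ₁' using fun j ↦ hcoordA j (x.1.2.1 j) (hx1 j) (hred₁0 j)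
      choose ζ₂ hζ₂ hζ₂' using fun j ↦ hcoordA j (x.1.2.2 j) (hx2 j) (hred₂0 j)
      refine ⟨(fun i ↦ Ideal.Quotient.mk _ (ζ₀ i),
        (fun j ↦ Ideal.Quotient.mk _ (ζ₁ j), fun j ↦ Ideal.Quotient.mk _ (ζ₂ j))), ?_, ?_⟩
      · refine Prod.ext (funext fun i ↦ ?_) (Prod.ext (funext fun j ↦ ?_) (funext fun j ↦ ?_))
        · show ϖ ^ (t + 2) • Ideal.Quotient.mk _ (ζ₀ i) = 0
          exact hζ₀' i
        · show ϖ ^ (t + 2) • Ideal.Quotient.mk _ (ζ₁ j) = 0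
          exact hζ₁' j
        · show ϖ ^ (t + 2) • Ideal.Quotient.mk _ (ζ₂ j) = 0
          exact hζ₂' j
      · refine Prod.ext (funext fun i ↦ ?_) (Prod.ext (funext fun j ↦ ?_) (funext fun j ↦ ?_))
        · show x.1.1 i = ϖ • Ideal.Quotient.mk _ (ζ₀ i)
          rw [smul_mk_eq]
          exact hζ₀ i
        · show x.1.2.1 j = ϖ • Ideal.Quotient.mk _ (ζ₁ j)
          rw [smul_mk_eq]
          exact hζ₁ j
        · show x.1.2.2 j = ϖ • Ideal.Quotient.mk _ (ζ₂ j)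
          rw [smul_mk_eq]
          exact hζ₂ j
    · rintro ⟨z, hz, hxz⟩ w
      rw [hP]
      refine Finset.sum_eq_zero fun j _ ↦ ?_
      rw [hxz, Prod.smul_snd, Prod.smul_fst, Prod.smul_snd, Pi.smul_apply, Pi.smul_apply, hred_ϖ, hred_ϖ,
        zero_mul, zero_mul, sub_zero]
  · -- RIGHT kernel `= ϖ^s·X[ϖ^{s+1}]`
    intro w
    constructor
    · intro h
      -- Step 1: the `J`-coordinates of `w` vanish
      have hv_tor : ∀ j, n j ≤ t + 1 →
          ϖ ^ (t + 1) • (Ideal.Quotient.mk (Ideal.span {ϖ ^ n j}) 1) = 0 := fun j hj ↦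
        pow_smul_mk_eq_zero_of_le (hIn j) hj 1
      have hx₁mem : ∀ j₀, n j₀ ≤ t + 1 → ((0 : Fin ε → R ⧸ Ideal.span {ϖ ^ e}),
          (Pi.single j₀ (Ideal.Quotient.mk (Ideal.span {ϖ ^ n j₀}) 1), (0 : Π j, R ⧸ Ideal.span {ϖ ^ n j})))
            ∈ A := fun j₀ hj₀ ↦ (hA _).2 (by
        rw [Prod.smul_mk, Prod.smul_mk, smul_zero, smul_zero, ← Pi.single_smul, hv_tor j₀ hj₀,
          Pi.single_zero, Prod.mk_zero_zero, Prod.mk_zero_zero])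
      have hx₂mem : ∀ j₀, n j₀ ≤ t + 1 → ((0 : Fin ε → R ⧸ Ideal.span {ϖ ^ e}),
          ((0 : Π j, R ⧸ Ideal.span {ϖ ^ n j}), Pi.single j₀ (Ideal.Quotient.mk (Ideal.span {ϖ ^ n j₀}) 1)))
            ∈ A := fun j₀ hj₀ ↦ (hA _).2 (by
        rw [Prod.smul_mk, Prod.smul_mk, smul_zero, smul_zero, ← Pi.single_smul, hv_tor j₀ hj₀,
          Pi.single_zero, Prod.mk_zero_zero, Prod.mk_zero_zero])
      have hred1 : ∀ j, red j (Ideal.Quotient.mk _ 1) = 1 := fun j ↦ by rw [hred, map_one]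
      have hw₂0 : ∀ j, n j ≤ t + 1 → w.1.2.2 j = 0 := by
        intro j₀ hj₀
        have h0 := h ⟨_, hx₁mem j₀ hj₀⟩
        rw [hP, Finset.sum_eq_single_of_mem j₀ ((hJ j₀).2 hj₀)] at h0
        · dsimp only at h0
          rw [Pi.single_eq_same, Pi.zero_apply, map_zero, zero_mul, sub_zero, hred1, one_mul, htop₂,
            Ideal.Quotient.eq_zero_iff_mem, mem_maximalIdeal_iff_dvd hϖ] at h0
          rw [hρ₂ w j₀]
          exact (mk_pow_pred_mul_eq_zero_iff hϖ (hn j₀).1 _).2 h0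
        · intro b _ hb
          dsimp only
          rw [Pi.single_eq_of_ne hb, Pi.zero_apply, map_zero, zero_mul, zero_mul, sub_zero]
      have hw₁0 : ∀ j, n j ≤ t + 1 → w.1.2.1 j = 0 := by
        intro j₀ hj₀
        have h0 := h ⟨_, hx₂mem j₀ hj₀⟩
        rw [hP, Finset.sum_eq_single_of_mem j₀ ((hJ j₀).2 hj₀)] at h0
        · dsimp only at h0
          rw [Pi.single_eq_same, Pi.zero_apply, map_zero, zero_mul, zero_sub, hred1, one_mul, neg_eq_zero,
            htop₁, Ideal.Quotient.eq_zero_iff_mem, mem_maximalIdeal_iff_dvd hϖ] at h0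
          rw [hρ₁ w j₀]
          exact (mk_pow_pred_mul_eq_zero_iff hϖ (hn j₀).1 _).2 h0
        · intro b _ hb
          dsimp only
          rw [Pi.single_eq_of_ne hb, Pi.zero_apply, map_zero, zero_mul, zero_mul, sub_zero]
      -- Step 2: divide every coordinate of `w` by `ϖ^{t+1}`
      have hw0 : ∀ i, ϖ ^ 1 • w.1.1 i = 0 := fun i ↦ by
        have h1 := congr_arg (fun y ↦ y.1 i) ((hB w).1 w.2)
        simpa only [Prod.smul_fst, Pi.smul_apply, Prod.fst_zero, Pi.zero_apply, pow_one] using h1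
      have hfree : ∀ i, ∃ ζ : R, w.1.1 i = Ideal.Quotient.mk _ (ϖ ^ (t + 1) * ζ) ∧
          ϖ ^ (t + 2) • Ideal.Quotient.mk (Ideal.span {ϖ ^ e}) ζ = 0 := by
        intro i
        obtain ⟨y, hy⟩ := exists_eq_mk_pow_sub_mul hϖ hIe 1 _ (hw0 i)
        refine ⟨ϖ ^ (e - t - 2) * y, ?_, pow_smul_mk_pow_mul_eq_zero_of_le hIe (by omega) y⟩
        rw [hy, ← mul_assoc, ← pow_add]
        congr 3
        omega
      have hcoordB : ∀ j (ρ : R),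
          (n j ≤ t + 1 → Ideal.Quotient.mk (Ideal.span {ϖ ^ n j}) (ϖ ^ (n j - 1) * ρ) = 0) →
          ∃ ζ : R, Ideal.Quotient.mk (Ideal.span {ϖ ^ n j}) (ϖ ^ (n j - 1) * ρ) =
              Ideal.Quotient.mk _ (ϖ ^ (t + 1) * ζ) ∧
            ϖ ^ (t + 2) • Ideal.Quotient.mk (Ideal.span {ϖ ^ n j}) ζ = 0 := by
        intro j ρ hzero
        by_cases hj : n j ≤ t + 1
        · refine ⟨0, ?_, by rw [map_zero, smul_zero]⟩
          rw [hzero hj, mul_zero, map_zero]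
        · refine ⟨ϖ ^ (n j - t - 2) * ρ, ?_, pow_smul_mk_pow_mul_eq_zero_of_le (hIn j) (by omega) ρ⟩
          rw [← mul_assoc, ← pow_add]
          congr 3
          omega
      choose ζ₀ hζ₀ hζ₀' using hfree
      choose ζ₁ hζ₁ hζ₁' using fun j ↦ hcoordB j (ρ₁ w j) (fun hj ↦ by rw [← hρ₁ w j]; exact hw₁0 j hj)
      choose ζ₂ hζ₂ hζ₂' using fun j ↦ hcoordB j (ρ₂ w j) (fun hj ↦ by rw [← hρ₂ w j]; exact hw₂0 j hj)
      refine ⟨(fun i ↦ Ideal.Quotient.mk _ (ζ₀ i),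
        (fun j ↦ Ideal.Quotient.mk _ (ζ₁ j), fun j ↦ Ideal.Quotient.mk _ (ζ₂ j))), ?_, ?_⟩
      · refine Prod.ext (funext fun i ↦ ?_) (Prod.ext (funext fun j ↦ ?_) (funext fun j ↦ ?_))
        · show ϖ ^ (t + 2) • Ideal.Quotient.mk _ (ζ₀ i) = 0
          exact hζ₀' i
        · show ϖ ^ (t + 2) • Ideal.Quotient.mk _ (ζ₁ j) = 0
          exact hζ₁' j
        · show ϖ ^ (t + 2) • Ideal.Quotient.mk _ (ζ₂ j) = 0
          exact hζ₂' j
      · refine Prod.ext (funext fun i ↦ ?_) (Prod.ext (funext fun j ↦ ?_) (funext fun j ↦ ?_))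
        · show w.1.1 i = ϖ ^ (t + 1) • Ideal.Quotient.mk _ (ζ₀ i)
          rw [smul_mk_eq]
          exact hζ₀ i
        · show w.1.2.1 j = ϖ ^ (t + 1) • Ideal.Quotient.mk _ (ζ₁ j)
          rw [smul_mk_eq, hρ₁ w j]
          exact hζ₁ j
        · show w.1.2.2 j = ϖ ^ (t + 1) • Ideal.Quotient.mk _ (ζ₂ j)
          rw [smul_mk_eq, hρ₂ w j]
          exact hζ₂ j
    · rintro ⟨z, hz, hwz⟩ x
      rw [hP]
      refine Finset.sum_eq_zero fun j hj ↦ ?_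
      have hj' : n j ≤ t + 1 := (hJ j).1 hj
      obtain ⟨ζ₁, hζ₁⟩ := Ideal.Quotient.mk_surjective (z.2.1 j)
      obtain ⟨ζ₂, hζ₂⟩ := Ideal.Quotient.mk_surjective (z.2.2 j)
      rw [hwz, Prod.smul_snd, Prod.smul_fst, Prod.smul_snd, Pi.smul_apply, Pi.smul_apply, ← hζ₁, ← hζ₂,
        pow_smul_mk_eq_zero_of_le (hIn j) hj', pow_smul_mk_eq_zero_of_le (hIn j) hj', htop0, mul_zero,
        mul_zero, sub_zero]
  · -- skew-symmetry
    intro a b a' b' ha' hb'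
    rw [hP, hP, ← Finset.sum_neg_distrib]
    refine Finset.sum_congr rfl fun j hj ↦ ?_
    have hj' : n j ≤ t + 1 := (hJ j).1 hj
    obtain ⟨α₁, hα₁⟩ := Ideal.Quotient.mk_surjective ((a : (Fin ε → R ⧸ Ideal.span {ϖ ^ e}) ×
      ((Π j, R ⧸ Ideal.span {ϖ ^ n j}) × (Π j, R ⧸ Ideal.span {ϖ ^ n j}))).2.1 j)
    obtain ⟨α₂, hα₂⟩ := Ideal.Quotient.mk_surjective ((a : (Fin ε → R ⧸ Ideal.span {ϖ ^ e}) ×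
      ((Π j, R ⧸ Ideal.span {ϖ ^ n j}) × (Π j, R ⧸ Ideal.span {ϖ ^ n j}))).2.2 j)
    obtain ⟨β₁, hβ₁⟩ := Ideal.Quotient.mk_surjective ((b : (Fin ε → R ⧸ Ideal.span {ϖ ^ e}) ×
      ((Π j, R ⧸ Ideal.span {ϖ ^ n j}) × (Π j, R ⧸ Ideal.span {ϖ ^ n j}))).2.1 j)
    obtain ⟨β₂, hβ₂⟩ := Ideal.Quotient.mk_surjective ((b : (Fin ε → R ⧸ Ideal.span {ϖ ^ e}) ×
      ((Π j, R ⧸ Ideal.span {ϖ ^ n j}) × (Π j, R ⧸ Ideal.span {ϖ ^ n j}))).2.2 j)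
    rw [ha', hb', Prod.smul_snd, Prod.smul_fst, Prod.smul_snd, Pi.smul_apply, Pi.smul_apply,
      Prod.smul_snd, Prod.smul_fst, Prod.smul_snd, Pi.smul_apply, Pi.smul_apply, ← hα₁, ← hα₂, ← hβ₁, ← hβ₂,
      htopA j hj', htopA j hj', htopA j hj', htopA j hj', hred, hred, hred, hred, map_mul, map_mul, map_mul,
      map_mul]
    ring

end Model

/-! ## §2 Transport along a linear equivalence -/

section Transport

variable {R : Type*} [CommRing R] [IsDomain R] [IsDiscreteValuationRing R] {ϖ : R}
  {V : Type*} [AddCommGroup V] [Module R V]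

/-- **TRANSPORT of the model pairing to any `R`-module `L ≅ (R/ϖ^e)^ε × (M × M)`**, `M = Π_j R/(ϖ^{n_j})`,
`1 ≤ n_j ≤ e`, sitting as a submodule `L ≤ V`: for `s = t + 1 < e` there is a bi-additive `R`-equivariant pairing
`P : L[ϖ^s] × L[ϖ] → R/𝔪` (domains as additive subgroups `A`, `B` of `V` cut out by membership) with LEFT kernel
`ϖ·L[ϖ^{s+1}]`, RIGHT kernel `ϖ^s·L[ϖ^{s+1}]` and `P(a, ϖ^t b) = -P(b, ϖ^t a)`.
[cite: Howard2004HeegnerKolyvagin, Thm. 1.4.2 (proof, displays (i)(ii)) (arXiv:1202.6340 p0008 L108–L142)] -/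
theorem exists_skewPairing_of_linearEquiv (hϖ : Irreducible ϖ) (ε m e : ℕ) (n : Fin m → ℕ)
    (hn : ∀ j, 1 ≤ n j ∧ n j ≤ e) (t : ℕ) (ht : t + 1 < e) (L : Submodule R V)
    (Φ : ↥L ≃ₗ[R] ((Fin ε → R ⧸ Ideal.span {ϖ ^ e}) ×
      ((Π j, R ⧸ Ideal.span {ϖ ^ n j}) × (Π j, R ⧸ Ideal.span {ϖ ^ n j}))))
    (A B : AddSubgroup V) (hA : ∀ x, x ∈ A ↔ x ∈ L ∧ ϖ ^ (t + 1) • x = 0)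
    (hB : ∀ w, w ∈ B ↔ w ∈ L ∧ ϖ • w = 0) :
    ∃ P : ↥A →+ ↥B →+ R ⧸ IsLocalRing.maximalIdeal R,
      (∀ (r : R) (x x' : ↥A) (w : ↥B), (x' : V) = r • (x : V) → P x' w = r • P x w) ∧
      (∀ (r : R) (x : ↥A) (w w' : ↥B), (w' : V) = r • (w : V) → P x w' = r • P x w) ∧
      (∀ x : ↥A, (∀ w, P x w = 0) ↔ ∃ z ∈ L, ϖ ^ (t + 2) • z = 0 ∧ (x : V) = ϖ • z) ∧
      (∀ w : ↥B, (∀ x, P x w = 0) ↔ ∃ z ∈ L, ϖ ^ (t + 2) • z = 0 ∧ (w : V) = ϖ ^ (t + 1) • z) ∧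
      (∀ (a b : ↥A) (a' b' : ↥B), (a' : V) = ϖ ^ t • (a : V) → (b' : V) = ϖ ^ t • (b : V) →
        P a b' = - P b a') := by
  classical
  -- the model subgroups
  let AX := (Submodule.torsionBy R ((Fin ε → R ⧸ Ideal.span {ϖ ^ e}) ×
      ((Π j, R ⧸ Ideal.span {ϖ ^ n j}) × (Π j, R ⧸ Ideal.span {ϖ ^ n j}))) (ϖ ^ (t + 1))).toAddSubgroup
  let BX := (Submodule.torsionBy R ((Fin ε → R ⧸ Ideal.span {ϖ ^ e}) ×
      ((Π j, R ⧸ Ideal.span {ϖ ^ n j}) × (Π j, R ⧸ Ideal.span {ϖ ^ n j}))) ϖ).toAddSubgroup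
  have hAX : ∀ y, y ∈ AX ↔ ϖ ^ (t + 1) • y = 0 := fun y ↦ by
    simp only [AX, Submodule.mem_toAddSubgroup, Submodule.mem_torsionBy_iff]
  have hBX : ∀ y, y ∈ BX ↔ ϖ • y = 0 := fun y ↦ by
    simp only [BX, Submodule.mem_toAddSubgroup, Submodule.mem_torsionBy_iff]
  obtain ⟨P₀, h₁, h₂, h₃, h₄, h₅⟩ := exists_skewPairing_model hϖ ε m e n hn t ht AX BX hAX hBX
  -- the comparison maps `α : A → AX`, `β : B → BX`
  have hαmem : ∀ x : ↥A, Φ ⟨x.1, ((hA x.1).1 x.2).1⟩ ∈ AX := fun x ↦ by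
    rw [hAX, ← map_smul, show ϖ ^ (t + 1) • (⟨x.1, ((hA x.1).1 x.2).1⟩ : ↥L) = 0 from
      Subtype.ext (by rw [Submodule.coe_smul, Submodule.coe_zero]; exact ((hA x.1).1 x.2).2), map_zero]
  have hβmem : ∀ w : ↥B, Φ ⟨w.1, ((hB w.1).1 w.2).1⟩ ∈ BX := fun w ↦ by
    rw [hBX, ← map_smul, show ϖ • (⟨w.1, ((hB w.1).1 w.2).1⟩ : ↥L) = 0 from
      Subtype.ext (by rw [Submodule.coe_smul, Submodule.coe_zero]; exact ((hB w.1).1 w.2).2), map_zero]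
  let α : ↥A →+ ↥AX := AddMonoidHom.mk' (fun x ↦ ⟨Φ ⟨x.1, ((hA x.1).1 x.2).1⟩, hαmem x⟩) (by
    intro x y
    refine Subtype.ext ?_
    show Φ ⟨(x + y).1, _⟩ = Φ ⟨x.1, _⟩ + Φ ⟨y.1, _⟩
    rw [← map_add]
    rfl)
  let β : ↥B →+ ↥BX := AddMonoidHom.mk' (fun w ↦ ⟨Φ ⟨w.1, ((hB w.1).1 w.2).1⟩, hβmem w⟩) (by
    intro x y
    refine Subtype.ext ?_
    show Φ ⟨(x + y).1, _⟩ = Φ ⟨x.1, _⟩ + Φ ⟨y.1, _⟩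
    rw [← map_add]
    rfl)
  have hα : ∀ x : ↥A, (α x).1 = Φ ⟨x.1, ((hA x.1).1 x.2).1⟩ := fun _ ↦ rfl
  have hβ : ∀ w : ↥B, (β w).1 = Φ ⟨w.1, ((hB w.1).1 w.2).1⟩ := fun _ ↦ rfl
  -- surjectivity of `α`, `β`
  have hαsurj : ∀ y : ↥AX, ∃ x : ↥A, α x = y := by
    intro y
    have hyL : ((Φ.symm y.1 : ↥L) : V) ∈ L := (Φ.symm y.1).2
    have hytor : ϖ ^ (t + 1) • ((Φ.symm y.1 : ↥L) : V) = 0 := by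
      rw [← Submodule.coe_smul, ← map_smul, (hAX y.1).1 y.2, map_zero, Submodule.coe_zero]
    refine ⟨⟨(Φ.symm y.1 : ↥L), (hA _).2 ⟨hyL, hytor⟩⟩, Subtype.ext ?_⟩
    rw [hα]
    exact (LinearEquiv.eq_symm_apply Φ).mp rfl
  have hβsurj : ∀ y : ↥BX, ∃ w : ↥B, β w = y := by
    intro y
    have hyL : ((Φ.symm y.1 : ↥L) : V) ∈ L := (Φ.symm y.1).2
    have hytor : ϖ • ((Φ.symm y.1 : ↥L) : V) = 0 := by
      rw [← Submodule.coe_smul, ← map_smul, (hBX y.1).1 y.2, map_zero, Submodule.coe_zero]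
    refine ⟨⟨(Φ.symm y.1 : ↥L), (hB _).2 ⟨hyL, hytor⟩⟩, Subtype.ext ?_⟩
    rw [hβ]
    exact (LinearEquiv.eq_symm_apply Φ).mp rfl
  -- scalar transport through `Φ`
  have hαsmul : ∀ (r : R) (x x' : ↥A), (x' : V) = r • (x : V) → (α x').1 = r • (α x).1 := by
    intro r x x' h
    rw [hα, hα, ← map_smul]
    congr 1
    exact Subtype.ext (by rw [Submodule.coe_smul]; exact h)
  have hβsmul : ∀ (r : R) (w w' : ↥B), (w' : V) = r • (w : V) → (β w').1 = r • (β w).1 := by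
    intro r w w' h
    rw [hβ, hβ, ← map_smul]
    congr 1
    exact Subtype.ext (by rw [Submodule.coe_smul]; exact h)
  have hβαsmul : ∀ (r : R) (a : ↥A) (a' : ↥B), (a' : V) = r • (a : V) → (β a').1 = r • (α a).1 := by
    intro r a a' h
    rw [hα, hβ, ← map_smul]
    congr 1
    exact Subtype.ext (by rw [Submodule.coe_smul]; exact h)
  refine ⟨(P₀.comp α).compl₂ β, ?_, ?_, ?_, ?_, ?_⟩
  · intro r x x' w hx'
    rw [AddMonoidHom.compl₂_apply, AddMonoidHom.compl₂_apply, AddMonoidHom.comp_apply, AddMonoidHom.comp_apply]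
    exact h₁ r (α x) (α x') (β w) (hαsmul r x x' hx')
  · intro r x w w' hw'
    rw [AddMonoidHom.compl₂_apply, AddMonoidHom.compl₂_apply, AddMonoidHom.comp_apply]
    exact h₂ r (α x) (β w) (β w') (hβsmul r w w' hw')
  · intro x
    constructor
    · intro h
      have h' : ∀ y : ↥BX, P₀ (α x) y = 0 := fun y ↦ by
        obtain ⟨w, rfl⟩ := hβsurj y
        have := h w
        rwa [AddMonoidHom.compl₂_apply, AddMonoidHom.comp_apply] at this
      obtain ⟨z, hz, hxz⟩ := (h₃ (α x)).1 h'
      refine ⟨((Φ.symm z : ↥L) : V), (Φ.symm z).2, ?_, ?_⟩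
      · rw [← Submodule.coe_smul, ← map_smul, hz, map_zero, Submodule.coe_zero]
      · rw [← Submodule.coe_smul, ← map_smul, ← hxz, hα, LinearEquiv.symm_apply_apply]
    · rintro ⟨z, hzL, hz, hxz⟩ w
      rw [AddMonoidHom.compl₂_apply, AddMonoidHom.comp_apply]
      refine (h₃ (α x)).2 ⟨Φ ⟨z, hzL⟩, ?_, ?_⟩ (β w)
      · rw [← map_smul, show ϖ ^ (t + 2) • (⟨z, hzL⟩ : ↥L) = 0 from
          Subtype.ext (by rw [Submodule.coe_smul, Submodule.coe_zero]; exact hz), map_zero]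
      · rw [hα, ← map_smul]
        congr 1
        exact Subtype.ext (by rw [Submodule.coe_smul]; exact hxz)
  · intro w
    constructor
    · intro h
      have h' : ∀ y : ↥AX, P₀ y (β w) = 0 := fun y ↦ by
        obtain ⟨x, rfl⟩ := hαsurj y
        have := h x
        rwa [AddMonoidHom.compl₂_apply, AddMonoidHom.comp_apply] at this
      obtain ⟨z, hz, hwz⟩ := (h₄ (β w)).1 h'
      refine ⟨((Φ.symm z : ↥L) : V), (Φ.symm z).2, ?_, ?_⟩
      · rw [← Submodule.coe_smul, ← map_smul, hz, map_zero, Submodule.coe_zero]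
      · rw [← Submodule.coe_smul, ← map_smul, ← hwz, hβ, LinearEquiv.symm_apply_apply]
    · rintro ⟨z, hzL, hz, hwz⟩ x
      rw [AddMonoidHom.compl₂_apply, AddMonoidHom.comp_apply]
      refine (h₄ (β w)).2 ⟨Φ ⟨z, hzL⟩, ?_, ?_⟩ (α x)
      · rw [← map_smul, show ϖ ^ (t + 2) • (⟨z, hzL⟩ : ↥L) = 0 from
          Subtype.ext (by rw [Submodule.coe_smul, Submodule.coe_zero]; exact hz), map_zero]
      · rw [hβ, ← map_smul]
        congr 1
        exact Subtype.ext (by rw [Submodule.coe_smul]; exact hwz)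
  · intro a b a' b' ha' hb'
    rw [AddMonoidHom.compl₂_apply, AddMonoidHom.compl₂_apply, AddMonoidHom.comp_apply, AddMonoidHom.comp_apply]
    exact h₅ (α a) (α b) (β a') (β b') (hβαsmul _ a a' ha') (hβαsmul _ b b' hb')

end Transport

end DecompositionModel

end Literature.NumberTheory.GaloisCohomology.Howard2004
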